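/- Copyright: the b2b-balaban cell (near-miss cell 7), T⁴-continuum fan-out, lineage t4-ne7b-p1 (node U5c COUNT
member).  Released under the licence of the surrounding project. -/
import Summits.QuantumFields.BalabanUV.T4Continuum.Support.HistoryBankingShrunkLedger82

/-!
# M5-2e (E6) — THE ABSORPTION AND CALIBRATION PARAMETERS OF THE PER-LEVEL DEAD-BOX LEDGER (a LEVER, not consumed by the
record of record): the feedback is absorbed at ANY ratio `η < 1` (factor `1∕(1 − η)` in place of A2's `2` at `η = ½`),
and the ledger is calibrated at ANY `lam` with `lam·(1 − η) > 1` (owner module of row NE7b, lineage `t4-ne7b-p1` gen 51;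
re-open object (α), ruling R-OWNER-51-1; refuter PRICING-NE7b v20 F109 «NIL at ratio one is TRUE but THIN»;
PRE-POSITIONING ONLY)

Summits-side support leaf of the T⁴-continuum cell (rung (B)+1 on a FINITE torus only; NOT infinite volume, NOT the
mass gap, NOT the Clay statement; NOT a proof of the spine estimate NE7b — the cell's OWN estimate, NOT PRINTED, NOT
PROVED).  [folklore] finite sums and real arithmetic over the lineage's own bricks (A2 `HistoryBankingFlatLedger.sum_lag_ite_le`,
E3 `HistoryBankingPedigreeLedger82.perStep82`, E4 `HistoryBankingShrunkLedger82.{sum_nfresh_le_bfee, compSum_id_le_of_lt_lag82}`,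
M5-2d `HistoryBankingJoinLag`, M5-1b `HistoryBankingFlatJunction`, A3c `HistoryBankingFloors`, `HistoryBankingBirthBookings`);
nothing printed is asserted, no cite-tagged hypothesis, no `def … : Prop`, zero `sorry`.  One `def` (the explicit class-linear
coefficient `cvolEta`).  B16 = [Balaban1989LargeFieldII] pp. 384–387 under audit; locators only.

WHY (refuter v20 F109: after M5-2e the ledgers' census sentence under reading (A) is «361.46·ρ, NIL iff ρ ≤ 1.21 … 1.56 —
NIL at ratio one, THIN (+0.08 … +0.19 orders)»).  The floor exchange `6·collar82 d` of (E4) is `collar82 d` × 2 × 3: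
the «2» is A2's absorption of the lagged feedback at the located smallness `ε·Γ ≤ ½` (`flat_total_le`), the «3» is the
calibration at `σ := 2·collar82 d`.  NEITHER IS INTRINSIC: (i) the feedback `ε = feed82 d∕2^j` is absorbed at ANY ratio
`η < 1` with the factor `1∕(1 − η)` (take the lag `j` ten steps longer and `η = 2^{−10}`), (ii) the raw ledger holds for
ANY `σ > 0` and `blin` is LINEAR in `u`, so the calibration that puts coefficient one on the booked life cost is a free
parameter `lam` with `lam·(1 − η) > 1`, trading the floor exchange `lam·collar82 d∕(lam·(1 − η) − 1)` (→ `collar82 d∕(1 − η)`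
as `lam → ∞`) against M5-1a's young-birth displays `5·lam·126^d` ∕ `8·lam·126^d` (→ tighter as `lam` grows).  THIS FILE:
§1 **`flat_total_le_eta`** — A2's flat total at absorption ratio `η` (`ε·L_u ≤ η < 1` ⇒
`TOTAL ≤ (1∕(1 − η))·(YOUNG + c_A·RECENT + c_F·L_u·FLOOR)`); §2 **`shrunk82_volume_le_eta`** (raw, any `σ > 0`, any
`η < 1` with `feed82 d·Γ ≤ η·2^j`): `Σ_{m≤K} u_m·V(m) ≤ (1∕(1 − η))·((1 + collar82 d∕σ)·lifeCost + (2^{d+2} + 14·561^d·Γ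
+ collar82 d·j·Γ² + 165^d·j·Γ)·blin u P)` — (E4)'s proof with `flat_total_le ↦ flat_total_le_eta`; §3 **`cvolEta d j Γ η`**
and the CALIBRATED **`shrunk82_volume_le_lifeCost_eta`**: for every `lam` with `1 < lam·(1 − η)`, under
`u_t·(lam·collar82 d∕(lam·(1 − η) − 1)) ≤ floorK C K R t`, `u_n·(5·lam·126^d) ≤ E₂R_n^{q′}`, `u_n·(8·lam·126^d) ≤ E₃R_n^{q′}`:
`Σ_{m≤K} u_m·V(m) ≤ lifeCost … G + cvolEta d j Γ η·blin u P`.  CONSISTENCY: at `η = ½`, `lam = 3` the floor display is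
`u_t·(6·collar82 d)` and `cvolEta d j Γ ½ = cvol82 d j Γ` (`cvolEta_half`) — (E4)'s `shrunk82_volume_le_lifeCost` VERBATIM
(`shrunk82_volume_le_lifeCost_of_eta`, stated AT ITS TYPE).
CENSUS NOTE (the OWNER's reading, CERTIFIED by balaban-calc «VOLUME-4» (v) = GRAMMAR v77 G40.6, calc-ref §42 concurring; not a
kernel fact).  Reading (A), lattice letter, `collar82 4∕64⁴ = 1 010 728 125∕2²⁴ = 60.2440`: at `η = 2^{−10}` (least admissible
lattice lag 75 — `2⁷⁴ < 2¹⁰·feed82 4·13⁴ < 2⁷⁵`, P-calc-g24-2; v1 of this note said 76, admissible but not least —, was 66; M5-2d's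
78) the (WS1) floor-exchange threshold is `60.244·lam∕(lam·(1 − η) − 1)·ρ` — `90.4987·ρ` at `lam = 3` (M5-1a's (WS2ᴸ) stays
`225.3479·ρ` and binds: NIL iff `ρ ≤ 1.9355 … 2.5074`), and the two clauses balance at `lam⋆ = 1.803775`, `V⋆ = 135.4923·ρ`
(at `lam = 1.8`: `135.8476·ρ` vs (WS2ᴸ) `135.2087·ρ`) ⇒ census-NIL iff `ρ ≤ 3.2107` (m′ = 1) … `4.1595` (m′ = 6): +0.5066 …
+0.6190 orders of room at ratio one where (E4) has +0.0816 … +0.1940; envelope over η: `135.3600∕(1 − η)·ρ`; ρ = cΛ∕c_{E₂}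
stays UNVALUED.  NOT CONSUMED: the record of record and
leaf-06's `VolumeDisplaysS82` stay at `(η, lam) = (½, 3)`; a re-instantiation is a later INTERFACE REQUEST if a referee ∕
refuter asks for the margin.
HONEST: the lineage's own bookkeeping; NE7b NOT proved; spine 0∕9.  HONEST DEPENDENCY (cell): continuum YM on T⁴ ⇐ BetaPertH ∧
nine spine estimates (0∕9 proved); BetaPertH ⇐ (D1) ∧ (D4) ∧ CAP+tail; G-an2-4 gates asym, D1 and NE2∕3∕4.  This file changes none of it.
-/

open Finset
open Literature.MathematicalPhysics.QuantumFieldTheory.Balaban1983to89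
open Literature.MathematicalPhysics.QuantumFieldTheory.Balaban1983to89.B13ScaleTransfer
open Literature.MathematicalPhysics.QuantumFieldTheory.Balaban1983to89.B16SProfile
open Literature.MathematicalPhysics.QuantumFieldTheory.Balaban1983to89.B16StoppingRule
open T4PersistenceDictionary T4PrintedShapeBanking T4TaggedShapeBanking T4BankedInduction T4BranchingRecordsGas
open Summit.QuantumFields.BalabanUV.T4Continuum.HistoryAdmissible
open Summit.QuantumFields.BalabanUV.T4Continuum.HistoryRealise
open Summit.QuantumFields.BalabanUV.T4Continuum.HistoryRealiseWeak
open Summit.QuantumFields.BalabanUV.T4Continuum.HistoryBankingPedigreeMax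
open Summit.QuantumFields.BalabanUV.T4Continuum.HistoryBankingPedigreeLedger
open Summit.QuantumFields.BalabanUV.T4Continuum.HistoryBankingFloors
open Summit.QuantumFields.BalabanUV.T4Continuum.HistoryBankingBirthBookings
open Summit.QuantumFields.BalabanUV.T4Continuum.HistoryBankingFlatLedger
open Summit.QuantumFields.BalabanUV.T4Continuum.HistoryBankingFlatJunction
open Summit.QuantumFields.BalabanUV.T4Continuum.HistoryBankingJoinLag
open Summit.QuantumFields.BalabanUV.T4Continuum.HistoryBankingAnchors82
open Summit.QuantumFields.BalabanUV.T4Continuum.HistoryBankingPedigreeLedger82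
open Summit.QuantumFields.BalabanUV.T4Continuum.HistoryBankingShrunkLedger82

namespace Summit.QuantumFields.BalabanUV.T4Continuum.HistoryBankingShrunkLedger82Eta

noncomputable section

open scoped Classical

variable {d : ℕ} {γ : Type*} {ε : Type*} [DecidableEq ε]

/-! ## §1 A2's flat total at ANY absorption ratio `η < 1` -/

/-- **THE FLAT TOTAL AT ABSORPTION RATIO `η`** (A2's `flat_total_le` with the located smallness `ε·L_u ≤ ½` REPLACED by
`ε·L_u ≤ η`, `η < 1`): from the per-step inequality `V m ≤ Y m + c_A·R m + [j ≤ m]·(c_F·N(m−j) + ε·V(m−j))` with `Y ≥ 0`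
at the performed steps, `Σ_{m≤K} u_m·V m ≤ (1∕(1 − η))·(Σ u_m·Y m + c_A·Σ u_m·R m + c_F·L_u·Σ u_m·N m)`. [folklore] -/
theorem flat_total_le_eta {u V Y N R : ℕ → ℝ} {K j : ℕ} {Lu cA cF ε η : ℝ} (hu : ∀ t, 0 ≤ u t) (hV : ∀ t, 0 ≤ V t)
    (hY : ∀ t, 0 ≤ Y t) (hN : ∀ t, 0 ≤ N t) (hRn : ∀ t, 0 ≤ R t) (hcA : 0 ≤ cA) (hLu0 : 0 ≤ Lu)
    (hLu : ∀ t, u (t + j) ≤ Lu * u t) (hcF : 0 ≤ cF) (hε : 0 ≤ ε)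
    (hstep : ∀ m, m ≤ K → V m ≤ Y m + cA * R m + (if j ≤ m then cF * N (m - j) + ε * V (m - j) else 0))
    (hsmall : ε * Lu ≤ η) (hη : η < 1) :
    ∑ m ∈ Finset.range (K + 1), u m * V m ≤
      (1 / (1 - η)) * ((∑ m ∈ Finset.range (K + 1), u m * Y m) + cA * (∑ m ∈ Finset.range (K + 1), u m * R m)
        + cF * Lu * (∑ m ∈ Finset.range (K + 1), u m * N m)) := by
  set TOT := ∑ m ∈ Finset.range (K + 1), u m * V m with hTOT
  have h1 : TOT ≤ ∑ m ∈ Finset.range (K + 1),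
      (u m * Y m + cA * (u m * R m) + (cF * (u m * (if j ≤ m then N (m - j) else 0))
        + ε * (u m * (if j ≤ m then V (m - j) else 0)))) := by
    refine Finset.sum_le_sum fun m hm => ?_
    rw [Finset.mem_range] at hm
    have h := mul_le_mul_of_nonneg_left (hstep m (by omega)) (hu m)
    have e : u m * (Y m + cA * R m + (if j ≤ m then cF * N (m - j) + ε * V (m - j) else 0)) =
        u m * Y m + cA * (u m * R m) + (cF * (u m * (if j ≤ m then N (m - j) else 0))
          + ε * (u m * (if j ≤ m then V (m - j) else 0))) := by
      split_ifs <;> ring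
    linarith
  rw [Finset.sum_add_distrib, Finset.sum_add_distrib, Finset.sum_add_distrib, ← Finset.mul_sum, ← Finset.mul_sum,
    ← Finset.mul_sum] at h1
  have hN' := sum_lag_ite_le (K := K) hu hN hLu0 hLu
  have hV' := sum_lag_ite_le (K := K) hu hV hLu0 hLu
  have h2 : cF * ∑ m ∈ Finset.range (K + 1), u m * (if j ≤ m then N (m - j) else 0) ≤
      cF * (Lu * ∑ t ∈ Finset.range (K + 1), u t * N t) := mul_le_mul_of_nonneg_left hN' hcF
  have h3 : ε * ∑ m ∈ Finset.range (K + 1), u m * (if j ≤ m then V (m - j) else 0) ≤ ε * (Lu * TOT) :=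
    mul_le_mul_of_nonneg_left hV' hε
  have hTOT0 : 0 ≤ TOT := Finset.sum_nonneg fun m _ => mul_nonneg (hu m) (hV m)
  have h4 : ε * (Lu * TOT) ≤ η * TOT := by
    rw [← mul_assoc]; exact mul_le_mul_of_nonneg_right hsmall hTOT0
  set A := (∑ m ∈ Finset.range (K + 1), u m * Y m) + cA * (∑ m ∈ Finset.range (K + 1), u m * R m)
    + cF * Lu * (∑ m ∈ Finset.range (K + 1), u m * N m) with hA
  have hA0 : 0 ≤ A := by
    have hY0 : 0 ≤ ∑ m ∈ Finset.range (K + 1), u m * Y m := Finset.sum_nonneg fun m _ => mul_nonneg (hu m) (hY m)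
    have hR0 : 0 ≤ ∑ m ∈ Finset.range (K + 1), u m * R m := Finset.sum_nonneg fun m _ => mul_nonneg (hu m) (hRn m)
    have hN0 : 0 ≤ ∑ m ∈ Finset.range (K + 1), u m * N m := Finset.sum_nonneg fun m _ => mul_nonneg (hu m) (hN m)
    rw [hA]; positivity
  have h5 : TOT ≤ A + η * TOT := by
    have : cF * (Lu * ∑ t ∈ Finset.range (K + 1), u t * N t) = cF * Lu * ∑ m ∈ Finset.range (K + 1), u m * N m := by
      ring
    linarith
  have h1η : 0 < 1 - η := by linarith
  rw [div_mul_eq_mul_div, one_mul, le_div_iff₀ h1η]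
  nlinarith

/-! ## §2 The per-level dead-box ledger at absorption ratio `η` (raw floor display) -/

section Assembly
variable {L : ℕ} {s R : ℕ → ℕ} {C : T4PrintedShapeBanking.Consts} {sh : ε → PEv}

/-- **THE PER-LEVEL DEAD-BOX LEDGER AT ABSORPTION RATIO `η` (raw displays).**  As `shrunk82_volume_le` with the feedback
smallness `feed82 d·Γ ≤ η·2^j` (`η < 1`) in place of `≤ 2^j∕2`:
`Σ_{m≤K} u_m·V(m) ≤ (1∕(1 − η))·((1 + collar82 d∕σ)·lifeCost (dictWT sh R C.n₁) (costT sh C K R) G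
  + (2^{d+2} + 14·561^d·Γ + collar82 d·j·Γ² + 165^d·j·Γ)·blin u P)`. [folklore] -/
theorem shrunk82_volume_le_eta (hL : 4 ≤ L) (hdrop : ∀ m, DropCtl s m) (hR : ∀ t, 1 ≤ R t) (hn₁ : 13 ≤ C.n₁)
    (hE₂ : 0 ≤ C.E₂) (hE₃ : 0 ≤ C.E₃) {P : PGen (Pt d × Finset (Pt d))} {Z : Finset (Pt d)}
    (hP : RealisesW L s R P Z) {G : Gen ε} (hsh : relabel sh G = P.toGen) (hW : G.WF (dictWT sh R C.n₁)) {K : ℕ}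
    (hPK : P.lastStep ≤ K) (hK : K < G.reach (dictWT sh R C.n₁)) {u : ℕ → ℝ} (hu : ∀ n, 0 ≤ u n) {Γ : ℝ}
    (hΓ0 : 0 ≤ Γ) (hΓ : ∀ t n, t ≤ n → u n ≤ Γ * u t) {j : ℕ} (hj1 : 1 ≤ j) {η : ℝ} (hη : η < 1)
    (hsmall : feed82 d * Γ ≤ η * 2 ^ j) {σ : ℝ} (hσ : 0 < σ)
    (huS : ∀ t, t ≤ K → u t * σ ≤ floorK C K R t)
    (huE₂ : ∀ n, n ≤ K → u n * (5 * 126 ^ d) ≤ C.E₂ * (R n : ℝ) ^ C.q')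
    (huE₃ : ∀ n, n ≤ K → u n * (8 * 126 ^ d) ≤ C.E₃ * (R n : ℝ) ^ C.q') :
    ∑ m ∈ Finset.range (K + 1), u m * compSum L s (fun v => (v : ℝ)) P m ≤
      (1 / (1 - η)) * ((1 + collar82 d / σ) * lifeCost (dictWT sh R C.n₁) (costT sh C K R) G
        + (2 ^ (d + 2) + 14 * 561 ^ d * Γ + collar82 d * j * Γ ^ 2 + 165 ^ d * j * Γ) * blin u P) := by
  set ε₀ : ℝ := feed82 d / 2 ^ j with hε₀
  have hε0 : 0 ≤ ε₀ := by have := feed82_nonneg d; positivity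
  set c : ℝ := collar82 d with hcdef
  have hc0 : 0 ≤ c := (collar82_pos d).le
  have hA : P.Adm K := adm_of_realisesW P Z hP hPK
  have hΓi : ∀ t i, i < j → u (t + i) ≤ Γ * u t := fun t i _ => hΓ t (t + i) (by omega)
  have hΓj : ∀ t, u (t + j) ≤ Γ * u t := fun t => hΓ t (t + j) (by omega)
  have hΓK : ∀ t n, t ≤ n → n ≤ K → u n ≤ Γ * u t := fun t n htn _ => hΓ t n htn
  -- (i) per-step inequality, collar at the paying level; (ii) §1's lagged sum; (iii) bookings; (iv) arithmetic
  set N : ℕ → ℝ := fun m => compSum L s (fun _ => (1 : ℝ)) P m with hNdef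
  set Y' : ℕ → ℝ := fun m => youngVol L s P m + (561 : ℝ) ^ d * (nfresh L s P m : ℝ)
    + c * (N m + (nj j P m : ℝ)) with hY'
  have hY'0 : ∀ m, 0 ≤ Y' m := fun m => by
    have h1 := youngVol_nonneg (L := L) (s := s) P m
    have h2 : 0 ≤ N m := compSum_nonneg (fun _ => zero_le_one) P m
    rw [hY']; positivity
  have hstep : ∀ m, m ≤ K → compSum L s (fun v => (v : ℝ)) P m ≤ Y' m + (165 : ℝ) ^ d * (nb j P m : ℝ)
      + (if j ≤ m then (0 : ℝ) * (0 : ℝ) + ε₀ * compSum L s (fun v => (v : ℝ)) P (m - j) else 0) := by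
    intro m _
    have hN0 : 0 ≤ N m := compSum_nonneg (fun _ => zero_le_one) P m
    have hnj0 : (0 : ℝ) ≤ (nj j P m : ℝ) := Nat.cast_nonneg _
    have hextra : (0 : ℝ) ≤ c * (N m + (nj j P m : ℝ)) := by positivity
    by_cases hjm : j ≤ m
    · rw [if_pos hjm]
      have h := perStep82 hL hdrop P Z hP (t := m - j) (m := m) (by omega)
      rw [show m - (m - j) = j by omega] at h
      have hlin := compSum_affine (L := L) (s := s) (feed82 d / 2 ^ j) c P (m - j)
      have hfun : (fun v : ℕ => collar82 d + feed82 d * (v : ℝ) / 2 ^ j) =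
          fun v : ℕ => feed82 d / 2 ^ j * (v : ℝ) + c := by
        funext v; rw [hcdef]; ring
      rw [hfun, hlin] at h
      rw [nb_eq_recent hjm]
      have hlag := compSum_one_lag_le (L := L) (s := s) hjm P hA
      have hmono : c * compSum L s (fun _ => (1 : ℝ)) P (m - j) ≤ c * (N m + (nj j P m : ℝ)) :=
        mul_le_mul_of_nonneg_left hlag hc0
      rw [hY']
      simp only
      linarith
    · rw [if_neg hjm, add_zero, hY']
      have h := compSum_id_le_of_lt_lag82 (show 2 ≤ L by omega) hdrop (by omega : m < j) P Z hP
      simp only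
      linarith
  have hsm : ε₀ * Γ ≤ η := by
    rw [hε₀]
    have h2 : (0 : ℝ) < 2 ^ j := by positivity
    rw [div_mul_eq_mul_div, div_le_iff₀ h2]
    linarith
  have hflat := flat_total_le_eta (u := u) (V := fun m => compSum L s (fun v => (v : ℝ)) P m) (Y := Y')
    (N := fun _ => (0 : ℝ)) (R := fun m => (nb j P m : ℝ)) (K := K) (j := j) (Lu := Γ) (cA := (165 : ℝ) ^ d)
    (cF := (0 : ℝ)) (ε := ε₀) (η := η) hu (fun t => compSum_nonneg (fun v => Nat.cast_nonneg v) P t) hY'0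
    (fun _ => le_rfl) (fun t => Nat.cast_nonneg _) (by positivity) hΓ0 hΓj le_rfl hε0 hstep hsm hη
  have hLC0 : 0 ≤ lifeCost (dictWT sh R C.n₁) (costT sh C K R) G :=
    lifeCost_nonneg (fun G n => costT_nonneg hE₂ hE₃ G n) G
  have hYb := sum_youngVol_le (K := K) (C := C) (R := R) hL hdrop hR hE₂ hE₃ hu huE₂ huE₃ P Z hP
  have hB := sum_bsum_le_lifeCost (K := K) hE₂ hE₃ hsh hW hK
  have hnb := sum_nb_le_bfee (K := K) (j := j) hu hΓi P
  have hnjs := sum_nj_le_jfee (K := K) (j := j) hu hΓi P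
  have hjb := jfee_le_bfee hu hΓ0 hΓK P hA
  have hbb := bfee_le_blin hu P
  have hbfee0 := bfee_nonneg hu P
  have hblin := blin_nonneg hu P
  have hfr := sum_nfresh_le_bfee (L := L) (s := s) (K := K) hu hΓ0 hΓ P
  have hNs : ∑ m ∈ Finset.range (K + 1), u m * N m ≤ lifeCost (dictWT sh R C.n₁) (costT sh C K R) G / σ := by
    have h1 := sum_ncomp_floorK_le_lifeCost hL hdrop hR sh hn₁ hE₂ hE₃ K hP hsh hW hK
    rw [le_div_iff₀ hσ, Finset.sum_mul]
    refine le_trans (Finset.sum_le_sum fun t ht => ?_) h1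
    rw [Finset.mem_range] at ht
    have hN0 := compSum_nonneg (L := L) (s := s) (fun _ => zero_le_one) P t
    calc u t * N t * σ = (u t * σ) * compSum L s (fun _ => (1 : ℝ)) P t := by rw [hNdef]; ring
      _ ≤ floorK C K R t * compSum L s (fun _ => (1 : ℝ)) P t := mul_le_mul_of_nonneg_right (huS t (by omega)) hN0
      _ = compSum L s (fun _ => (1 : ℝ)) P t * floorK C K R t := mul_comm _ _
  have hY'sum : ∑ m ∈ Finset.range (K + 1), u m * Y' m =
      ∑ m ∈ Finset.range (K + 1), u m * youngVol L s P m
        + 561 ^ d * ∑ m ∈ Finset.range (K + 1), u m * (nfresh L s P m : ℝ)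
        + c * (∑ m ∈ Finset.range (K + 1), u m * N m + ∑ m ∈ Finset.range (K + 1), u m * (nj j P m : ℝ)) := by
    rw [hY', mul_add, Finset.mul_sum, Finset.mul_sum, Finset.mul_sum, ← Finset.sum_add_distrib,
      ← Finset.sum_add_distrib, ← Finset.sum_add_distrib]
    exact Finset.sum_congr rfl fun m _ => by ring
  set LC := lifeCost (dictWT sh R C.n₁) (costT sh C K R) G with hLC
  have hj0 : (0 : ℝ) ≤ j := Nat.cast_nonneg j
  have t1 : ∑ m ∈ Finset.range (K + 1), u m * (nj j P m : ℝ) ≤ j * Γ * (Γ * blin u P) := by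
    refine hnjs.trans (mul_le_mul_of_nonneg_left (hjb.trans ?_) (by positivity))
    exact mul_le_mul_of_nonneg_left hbb hΓ0
  have t2 : ∑ m ∈ Finset.range (K + 1), u m * (nb j P m : ℝ) ≤ j * Γ * blin u P :=
    hnb.trans (mul_le_mul_of_nonneg_left hbb (by positivity))
  have t3 : ∑ m ∈ Finset.range (K + 1), u m * youngVol L s P m ≤ 2 ^ d * 4 * blin u P + LC := hYb.trans (by linarith)
  have t4 : c * (∑ m ∈ Finset.range (K + 1), u m * N m
      + ∑ m ∈ Finset.range (K + 1), u m * (nj j P m : ℝ)) ≤ c * (LC / σ + j * Γ * (Γ * blin u P)) :=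
    mul_le_mul_of_nonneg_left (add_le_add hNs t1) hc0
  have t5 : (165 : ℝ) ^ d * ∑ m ∈ Finset.range (K + 1), u m * (nb j P m : ℝ) ≤ 165 ^ d * (j * Γ * blin u P) :=
    mul_le_mul_of_nonneg_left t2 (by positivity)
  have t6 : (561 : ℝ) ^ d * ∑ m ∈ Finset.range (K + 1), u m * (nfresh L s P m : ℝ) ≤ 561 ^ d * (14 * Γ * blin u P) := by
    refine mul_le_mul_of_nonneg_left (hfr.trans ?_) (by positivity)
    exact mul_le_mul_of_nonneg_left hbb (by positivity)
  have h1η' : 0 < 1 - η := by linarith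
  have h1η : 0 < 1 / (1 - η) := by positivity
  have hfin : ((2 ^ d * 4 * blin u P + LC) + 561 ^ d * (14 * Γ * blin u P) + c * (LC / σ + j * Γ * (Γ * blin u P))
      + 165 ^ d * (j * Γ * blin u P)) =
      (1 + c / σ) * LC + (2 ^ (d + 2) + 14 * 561 ^ d * Γ + c * j * Γ ^ 2 + 165 ^ d * j * Γ) * blin u P := by
    rw [pow_add]; field_simp; ring
  have hflat' : ∑ m ∈ Finset.range (K + 1), u m * compSum L s (fun v => (v : ℝ)) P m ≤
      (1 / (1 - η)) * ((∑ m ∈ Finset.range (K + 1), u m * Y' m)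
        + 165 ^ d * ∑ m ∈ Finset.range (K + 1), u m * (nb j P m : ℝ)) := by
    have e0 : (0 : ℝ) * Γ * ∑ m ∈ Finset.range (K + 1), u m * (0 : ℝ) = 0 := by ring
    rw [e0, add_zero] at hflat
    exact hflat
  rw [hY'sum] at hflat'
  have hsum_le : (∑ m ∈ Finset.range (K + 1), u m * youngVol L s P m
        + 561 ^ d * ∑ m ∈ Finset.range (K + 1), u m * (nfresh L s P m : ℝ)
        + c * (∑ m ∈ Finset.range (K + 1), u m * N m + ∑ m ∈ Finset.range (K + 1), u m * (nj j P m : ℝ)))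
      + 165 ^ d * ∑ m ∈ Finset.range (K + 1), u m * (nb j P m : ℝ) ≤
      (1 + c / σ) * LC + (2 ^ (d + 2) + 14 * 561 ^ d * Γ + c * j * Γ ^ 2 + 165 ^ d * j * Γ) * blin u P := by
    linarith [t3, t4, t5, t6, hfin.le]
  exact hflat'.trans (mul_le_mul_of_nonneg_left hsum_le h1η.le)

end Assembly

/-! ## §3 The calibrated form at `(η, lam)` and the consistency with (E4) at `(½, 3)` -/

section Calibrated

/-- **THE CLASS-LINEAR COEFFICIENT AT ABSORPTION RATIO `η`**:
`cvolEta d j Γ η = (1∕(1 − η))·(2^{d+2} + 14·561^d·Γ + collar82 d·j·Γ² + 165^d·j·Γ)`. [folklore] -/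
def cvolEta (d j : ℕ) (Γ η : ℝ) : ℝ :=
  (1 / (1 - η)) * (2 ^ (d + 2) + 14 * 561 ^ d * Γ + collar82 d * j * Γ ^ 2 + 165 ^ d * j * Γ)

/-- at `η = ½` the coefficient is (E4)'s `cvol82` [folklore] -/
theorem cvolEta_half (d j : ℕ) (Γ : ℝ) : cvolEta d j Γ (1 / 2) = cvol82 d j Γ := by
  unfold cvolEta cvol82; rw [pow_add]; norm_num; ring

/-- the coefficient is positive (`Γ ≥ 0`, `η < 1`) [folklore] -/
theorem cvolEta_pos (d j : ℕ) {Γ η : ℝ} (hΓ0 : 0 ≤ Γ) (hη : η < 1) : 0 < cvolEta d j Γ η := by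
  unfold cvolEta
  have hc := collar82_pos d
  have h1 : 0 < 1 - η := by linarith
  have h2 : (0 : ℝ) < 2 ^ (d + 2) + 14 * 561 ^ d * Γ + collar82 d * j * Γ ^ 2 + 165 ^ d * j * Γ := by positivity
  positivity

variable {L : ℕ} {s R : ℕ → ℕ} {C : T4PrintedShapeBanking.Consts} {sh : ε → PEv}

/-- **THE COST SIDE OF THE TOTAL-FORM BINDER AT `(η, lam)`** — the calibrated per-level dead-box ledger with both parameters
free: `η < 1`, `1 < lam·(1 − η)`; floor display `u_t·(lam·collar82 d∕(lam·(1 − η) − 1)) ≤ floorK C K R t`, young-birth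
displays `u_n·(5·lam·126^d) ≤ E₂R_n^{q′}`, `u_n·(8·lam·126^d) ≤ E₃R_n^{q′}`, feedback `feed82 d·Γ ≤ η·2^j`:
`Σ_{m≤K} u_m·V(m) ≤ lifeCost (dictWT sh R C.n₁) (costT sh C K R) G + cvolEta d j Γ η·blin u P`. [folklore] -/
theorem shrunk82_volume_le_lifeCost_eta (hL : 4 ≤ L) (hdrop : ∀ m, DropCtl s m) (hR : ∀ t, 1 ≤ R t) (hn₁ : 13 ≤ C.n₁)
    (hE₂ : 0 ≤ C.E₂) (hE₃ : 0 ≤ C.E₃) {P : PGen (Pt d × Finset (Pt d))} {Z : Finset (Pt d)}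
    (hP : RealisesW L s R P Z) {G : Gen ε} (hsh : relabel sh G = P.toGen) (hW : G.WF (dictWT sh R C.n₁)) {K : ℕ}
    (hPK : P.lastStep ≤ K) (hK : K < G.reach (dictWT sh R C.n₁)) {u : ℕ → ℝ} (hu : ∀ n, 0 ≤ u n) {Γ : ℝ}
    (hΓ0 : 0 ≤ Γ) (hΓ : ∀ t n, t ≤ n → u n ≤ Γ * u t) {j : ℕ} (hj1 : 1 ≤ j) {η : ℝ} (hη : η < 1)
    (hsmall : feed82 d * Γ ≤ η * 2 ^ j) {lam : ℝ} (hlam : 1 < lam * (1 - η))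
    (huS : ∀ t, t ≤ K → u t * (lam * collar82 d / (lam * (1 - η) - 1)) ≤ floorK C K R t)
    (huE₂ : ∀ n, n ≤ K → u n * (5 * lam * 126 ^ d) ≤ C.E₂ * (R n : ℝ) ^ C.q')
    (huE₃ : ∀ n, n ≤ K → u n * (8 * lam * 126 ^ d) ≤ C.E₃ * (R n : ℝ) ^ C.q') :
    ∑ m ∈ Finset.range (K + 1), u m * compSum L s (fun v => (v : ℝ)) P m ≤
      lifeCost (dictWT sh R C.n₁) (costT sh C K R) G + cvolEta d j Γ η * blin u P := by
  have hc := collar82_pos d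
  have h1η : 0 < 1 - η := by linarith
  have hden : 0 < lam * (1 - η) - 1 := by linarith
  have hl0 : 0 < lam := by nlinarith
  set σ : ℝ := collar82 d / (lam * (1 - η) - 1) with hσdef
  have hσ : 0 < σ := by rw [hσdef]; positivity
  have hu' : ∀ n, 0 ≤ lam * u n := fun n => mul_nonneg hl0.le (hu n)
  have hΓ' : ∀ t n, t ≤ n → lam * u n ≤ Γ * (lam * u t) := fun t n htn => by
    have := mul_le_mul_of_nonneg_left (hΓ t n htn) hl0.le
    linarith [this]
  have hσid : lam * σ = lam * collar82 d / (lam * (1 - η) - 1) := by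
    rw [hσdef]; field_simp
  have huS' : ∀ t, t ≤ K → lam * u t * σ ≤ floorK C K R t := fun t ht => by
    have e : lam * u t * σ = u t * (lam * collar82 d / (lam * (1 - η) - 1)) := by rw [← hσid]; ring
    rw [e]; exact huS t ht
  have huE₂' : ∀ n, n ≤ K → lam * u n * (5 * 126 ^ d) ≤ C.E₂ * (R n : ℝ) ^ C.q' := fun n hn => by
    have e : lam * u n * (5 * 126 ^ d) = u n * (5 * lam * 126 ^ d) := by ring
    rw [e]; exact huE₂ n hn
  have huE₃' : ∀ n, n ≤ K → lam * u n * (8 * 126 ^ d) ≤ C.E₃ * (R n : ℝ) ^ C.q' := fun n hn => by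
    have e : lam * u n * (8 * 126 ^ d) = u n * (8 * lam * 126 ^ d) := by ring
    rw [e]; exact huE₃ n hn
  have h := shrunk82_volume_le_eta (u := fun n => lam * u n) hL hdrop hR hn₁ hE₂ hE₃ hP hsh hW hPK hK hu' hΓ0 hΓ' hj1
    hη hsmall hσ huS' huE₂' huE₃'
  have hcoef : (1 / (1 - η)) * (1 + collar82 d / σ) = lam := by
    rw [hσdef]; field_simp; ring
  have hb : blin (fun n => lam * u n) P = lam * blin u P := blin_smul lam u P
  have hs : ∑ m ∈ Finset.range (K + 1), lam * u m * compSum L s (fun v => (v : ℝ)) P m =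
      lam * ∑ m ∈ Finset.range (K + 1), u m * compSum L s (fun v => (v : ℝ)) P m := by
    rw [Finset.mul_sum]; exact Finset.sum_congr rfl fun m _ => by ring
  rw [hb, hs, mul_add, ← mul_assoc, hcoef] at h
  have h' : lam * ∑ m ∈ Finset.range (K + 1), u m * compSum L s (fun v => (v : ℝ)) P m ≤
      lam * (lifeCost (dictWT sh R C.n₁) (costT sh C K R) G + cvolEta d j Γ η * blin u P) := by
    unfold cvolEta; linarith [h]
  exact le_of_mul_le_mul_left h' hl0

/-- **CONSISTENCY WITH (E4)**: at `(η, lam) = (½, 3)` the floor display is `u_t·(6·collar82 d)`, the young-birth displays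
are `15·126^d` ∕ `24·126^d`, the feedback clause is `feed82 d·Γ ≤ 2^j∕2` and the weight is `cvol82` — `shrunk82_volume_le_lifeCost`
re-derived through the two-parameter road, stated AT ITS TYPE. [folklore] -/
theorem shrunk82_volume_le_lifeCost_of_eta (hL : 4 ≤ L) (hdrop : ∀ m, DropCtl s m) (hR : ∀ t, 1 ≤ R t)
    (hn₁ : 13 ≤ C.n₁) (hE₂ : 0 ≤ C.E₂) (hE₃ : 0 ≤ C.E₃) {P : PGen (Pt d × Finset (Pt d))} {Z : Finset (Pt d)}
    (hP : RealisesW L s R P Z) {G : Gen ε} (hsh : relabel sh G = P.toGen) (hW : G.WF (dictWT sh R C.n₁)) {K : ℕ}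
    (hPK : P.lastStep ≤ K) (hK : K < G.reach (dictWT sh R C.n₁)) {u : ℕ → ℝ} (hu : ∀ n, 0 ≤ u n) {Γ : ℝ}
    (hΓ0 : 0 ≤ Γ) (hΓ : ∀ t n, t ≤ n → u n ≤ Γ * u t) {j : ℕ} (hj1 : 1 ≤ j)
    (hsmall : feed82 d * Γ ≤ 2 ^ j / 2)
    (huS : ∀ t, t ≤ K → u t * (6 * collar82 d) ≤ floorK C K R t)
    (huE₂ : ∀ n, n ≤ K → u n * (15 * 126 ^ d) ≤ C.E₂ * (R n : ℝ) ^ C.q')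
    (huE₃ : ∀ n, n ≤ K → u n * (24 * 126 ^ d) ≤ C.E₃ * (R n : ℝ) ^ C.q') :
    ∑ m ∈ Finset.range (K + 1), u m * compSum L s (fun v => (v : ℝ)) P m ≤
      lifeCost (dictWT sh R C.n₁) (costT sh C K R) G + cvol82 d j Γ * blin u P := by
  rw [← cvolEta_half]
  refine shrunk82_volume_le_lifeCost_eta hL hdrop hR hn₁ hE₂ hE₃ hP hsh hW hPK hK hu hΓ0 hΓ hj1 (η := 1 / 2)
    (by norm_num) (by linarith) (lam := 3) (by norm_num) ?_ ?_ ?_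
  · intro t ht; have := huS t ht; norm_num; linarith
  · intro n hn; have := huE₂ n hn; norm_num; linarith
  · intro n hn; have := huE₃ n hn; norm_num; linarith

/-- the certificate that the consistency theorem IS (E4)'s calibrated form by type [folklore] -/
example (hL : 4 ≤ L) (hdrop : ∀ m, DropCtl s m) (hR : ∀ t, 1 ≤ R t)
    (hn₁ : 13 ≤ C.n₁) (hE₂ : 0 ≤ C.E₂) (hE₃ : 0 ≤ C.E₃) {P : PGen (Pt d × Finset (Pt d))} {Z : Finset (Pt d)}
    (hP : RealisesW L s R P Z) {G : Gen ε} (hsh : relabel sh G = P.toGen) (hW : G.WF (dictWT sh R C.n₁)) {K : ℕ}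
    (hPK : P.lastStep ≤ K) (hK : K < G.reach (dictWT sh R C.n₁)) {u : ℕ → ℝ} (hu : ∀ n, 0 ≤ u n) {Γ : ℝ}
    (hΓ0 : 0 ≤ Γ) (hΓ : ∀ t n, t ≤ n → u n ≤ Γ * u t) {j : ℕ} (hj1 : 1 ≤ j)
    (hsmall : feed82 d * Γ ≤ 2 ^ j / 2)
    (huS : ∀ t, t ≤ K → u t * (6 * collar82 d) ≤ floorK C K R t)
    (huE₂ : ∀ n, n ≤ K → u n * (15 * 126 ^ d) ≤ C.E₂ * (R n : ℝ) ^ C.q')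
    (huE₃ : ∀ n, n ≤ K → u n * (24 * 126 ^ d) ≤ C.E₃ * (R n : ℝ) ^ C.q') :
    type_of% (shrunk82_volume_le_lifeCost hL hdrop hR hn₁ hE₂ hE₃ hP hsh hW hPK hK hu hΓ0 hΓ hj1 hsmall huS huE₂ huE₃) :=
  shrunk82_volume_le_lifeCost_of_eta hL hdrop hR hn₁ hE₂ hE₃ hP hsh hW hPK hK hu hΓ0 hΓ hj1 hsmall huS huE₂ huE₃

end Calibrated

end

end Summit.QuantumFields.BalabanUV.T4Continuum.HistoryBankingShrunkLedger82Eta
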